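import Summits.NavierStokesRegularity.NavierStokesRegularity.Theorems.FilamentSkeletonRssCoreLinearInvertibilityArnoldModeOne1DEnergy

/-!
# Tools for stub `stub_arnoldModeOne1D` (crux `CoreLinearInvertibility`,
# stmt-NavierStokesRegularity-17973, route `FilamentSkeletonRss`, line `Sketch`) — part D: the neutral mode

The `k = 1` neutral direction is `a⋆(r) = r e^{−r²/4}` (first mode of `∂_j G`), with
`A⋆(r) = ∫₀ʳ s³e^{−s²/4} = 8 − 2(r²+4)e^{−r²/4}`, `B⋆(r) = ∫ᵣ^∞ s e^{−s²/4} = 2e^{−r²/4}`. This file: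

* the second trace identity `∫₀^∞ r G(r) dr = ½∫ rΦ`, `G(r) = ∫ᵣ^∞ Φ/s` (`Φ = kerWeight`);
* the CROSS IDENTITY `½∫ (A_g A⋆/r³ + r B_g B⋆) dr = ∫ 4(1 − e^{−r²/4}) g dr` (`= ⟨g, a⋆⟩_{L²(Φ⁻¹ r dr)}`)
  for every Gaussian-class `g` — one integration by parts with `V = −4(1−e^{−r²/4})/r²`,
  `W = 4(1−e^{−r²/4})`, `V' = A⋆/r³`, `W' = rB⋆` (`a⋆` is the top eigenvector of `A⁻¹B₁`);
* the energy of `a⋆`: `½∫(A⋆²/r³ + rB⋆²) = ‖a⋆‖² = 4`.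

Folklore calculus; no definitions.
-/

set_option linter.dupNamespace false

noncomputable section

namespace Summit.NavierStokesRegularity.NavierStokesRegularity.Theorems

open Set Function Filter MeasureTheory Topology
open Literature.Analysis.FluidPDE

/-! ### The trace identities -/

/-- **Second trace identity** `∫₀^∞ r G(r) dr = ½∫₀^∞ rΦ(r) dr`, `G(r) = ∫ᵣ^∞ Φ/s` (by parts with
`Ψ = r²G/2`), with the integrability of `r G(r)` on `(0, ∞)`. Together with the first:
`½∫(F/r³ + rG) = ½∫ rΦ = tr B̃₁`. [folklore] -/
theorem am1_integral_mul_G :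
    IntegrableOn (fun r : ℝ => r * ∫ s in Ioi r, kerWeight s / s) (Ioi 0) ∧
      ∫ r in Ioi (0 : ℝ), r * ∫ s in Ioi r, kerWeight s / s = (1 / 2) * ∫ r in Ioi (0 : ℝ), r * kerWeight r := by
  set G : ℝ → ℝ := fun r => ∫ s in Ioi r, kerWeight s / s with hG
  set IΦ : ℝ := ∫ s in Ioi (0 : ℝ), kerWeight s with hIΦ
  have hIΦ0 : 0 ≤ IΦ := setIntegral_nonneg measurableSet_Ioi fun s _ => (kerWeight_pos s).le
  have hq : ContinuousOn (fun s : ℝ => kerWeight s / s) (Ioi 0) :=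
    continuous_kerWeight.continuousOn.div continuousOn_id fun s hs => ne_of_gt hs
  -- `G a = ∫_a^b Φ/s + G b` for `0 < a ≤ b`
  have hsplit : ∀ a b : ℝ, 0 < a → a ≤ b → G a = (∫ s in a..b, kerWeight s / s) + G b := by
    intro a b ha hab
    have hia := (am1_G_bounds ha).1
    simp only [hG]
    rw [← Ioc_union_Ioi_eq_Ioi hab, setIntegral_union (Ioc_disjoint_Ioi le_rfl) measurableSet_Ioi
      (hia.mono_set Ioc_subset_Ioi_self) (hia.mono_set (Ioi_subset_Ioi hab)),
      intervalIntegral.integral_of_le hab]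
  have hrepr : ∀ r : ℝ, 0 < r → G r = G 1 - ∫ s in (1 : ℝ)..r, kerWeight s / s := by
    intro r hr
    rcases le_total r 1 with h | h
    · rw [hsplit r 1 hr h, intervalIntegral.integral_symm]; ring
    · rw [hsplit 1 r zero_lt_one h]; ring
  have hG' : ∀ r, 0 < r → HasDerivAt G (-(kerWeight r / r)) r := by
    intro r hr
    have hii : IntervalIntegrable (fun s : ℝ => kerWeight s / s) volume 1 r :=
      (hq.mono fun s hs => lt_of_lt_of_le (lt_min zero_lt_one hr) hs.1).intervalIntegrable
    have h1 : HasDerivAt (fun x : ℝ => G 1 - ∫ s in (1 : ℝ)..x, kerWeight s / s) (-(kerWeight r / r)) r :=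
      (intervalIntegral.integral_hasDerivAt_right hii
        (hq.stronglyMeasurableAtFilter isOpen_Ioi r hr) (hq.continuousAt (Ioi_mem_nhds hr))).const_sub _
    refine h1.congr_of_eventuallyEq ?_
    filter_upwards [Ioi_mem_nhds hr] with x hx using hrepr x hx
  have hGc : ContinuousOn G (Ioi 0) := fun r hr => (hG' r hr).continuousAt.continuousWithinAt
  -- integrability of `r G(r)`
  have hGi : IntegrableOn (fun r : ℝ => r * G r) (Ioi 0) := by
    refine am1_integrableOn_of_bounds (M := IΦ) (ψ := fun r => 4 * Real.exp (-(r ^ 2 / 8)))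
      (continuousOn_id.mul hGc) (fun r hr0 hr1 => ?_)
      ((am1_integrableOn_exp_neg_sq.1.mono_set (Ioi_subset_Ioi zero_le_one)).const_mul 4) (fun r hr => ?_)
    · obtain ⟨-, h0, h1, -⟩ := am1_G_bounds hr0
      rw [abs_mul, abs_of_pos hr0, abs_of_nonneg h0]
      calc r * G r ≤ r * (IΦ / r) := mul_le_mul_of_nonneg_left h1 hr0.le
        _ = IΦ := by field_simp
    · have hr0 : 0 < r := zero_lt_one.trans hr
      obtain ⟨-, h0, -, h2⟩ := am1_G_bounds hr0
      rw [abs_mul, abs_of_pos hr0, abs_of_nonneg h0]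
      calc r * G r ≤ r * G r * r := le_mul_of_one_le_right (mul_nonneg hr0.le h0) hr.le
        _ = r ^ 2 * G r := by ring
        _ ≤ 4 * Real.exp (-(r ^ 2 / 8)) := h2
  refine ⟨hGi, ?_⟩
  set Ψ : ℝ → ℝ := fun r => (1 / 2) * (r ^ 2 * G r) with hΨ
  have hderiv : ∀ r, 0 < r → HasDerivAt Ψ (r * G r - (1 / 2) * (r * kerWeight r)) r := by
    intro r hr
    have h := ((hasDerivAt_pow 2 r).mul (hG' r hr)).const_mul (1 / 2)
    refine h.congr_deriv ?_
    push_cast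
    field_simp
    ring
  have h0 : Tendsto Ψ (𝓝[>] 0) (𝓝 0) := by
    refine am1_tendsto_zero_nhdsGT (b := fun r => (1 / 2) * (r * IΦ)) (by fun_prop) (by simp) fun r hr => ?_
    obtain ⟨-, hG0, h1, -⟩ := am1_G_bounds hr
    simp only [hΨ]
    rw [abs_mul, abs_of_pos (by norm_num : (0 : ℝ) < 1 / 2), abs_of_nonneg (by positivity)]
    refine mul_le_mul_of_nonneg_left ?_ (by norm_num)
    calc r ^ 2 * G r ≤ r ^ 2 * (IΦ / r) := mul_le_mul_of_nonneg_left h1 (sq_nonneg r)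
      _ = r * IΦ := by field_simp
  have hinf : Tendsto Ψ atTop (𝓝 0) := by
    have hb1 : Tendsto (fun r : ℝ => (1 / 2) * (4 * Real.exp (-(r ^ 2 / 8)))) atTop (𝓝 0) := by
      have h := ((am1_tendsto_pow_mul_exp_neg_sq 0 (by norm_num : (0 : ℝ) < 8)).const_mul 4).const_mul (1 / 2)
      simp only [mul_zero, pow_zero, one_mul] at h
      exact h
    refine squeeze_zero_norm' ?_ hb1
    filter_upwards [eventually_gt_atTop (0 : ℝ)] with r hr
    obtain ⟨-, hG0, -, h2⟩ := am1_G_bounds hr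
    rw [Real.norm_eq_abs]
    simp only [hΨ]
    rw [abs_mul, abs_of_pos (by norm_num : (0 : ℝ) < 1 / 2), abs_of_nonneg (by positivity)]
    exact mul_le_mul_of_nonneg_left h2 (by norm_num)
  have hΦi : IntegrableOn (fun r : ℝ => (1 / 2) * (r * kerWeight r)) (Ioi 0) :=
    integrableOn_mul_kerWeight.const_mul _
  have hzero := am1_integral_Ioi_eq_zero_of_hasDerivAt hderiv (hGi.sub hΦi) h0 hinf
  rw [integral_sub hGi hΦi, sub_eq_zero, MeasureTheory.integral_const_mul] at hzero
  exact hzero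

/-! ### The neutral mode `a⋆ = r e^{−r²/4}` -/

/-- `d/dr e^{−r²/4} = −(r/2) e^{−r²/4}`. [folklore] -/
theorem am1_hasDerivAt_gauss (r : ℝ) :
    HasDerivAt (fun x : ℝ => Real.exp (-(x ^ 2 / 4))) (-(r / 2) * Real.exp (-(r ^ 2 / 4))) r := by
  have h1 : HasDerivAt (fun x : ℝ => -(x ^ 2 / 4)) (-(r / 2)) r := by
    have h := (hasDerivAt_pow 2 r).const_mul (-(1 / 4 : ℝ))
    refine (h.congr_of_eventuallyEq (Eventually.of_forall fun y => ?_)).congr_deriv ?_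
    · simp only; ring
    · push_cast; ring
  exact ((Real.hasDerivAt_exp _).comp r h1).congr_deriv (by ring)

/-- `1 − r²/4 ≤ e^{−r²/4} ≤ 1`, i.e. `0 ≤ 4(1 − e^{−r²/4}) ≤ r²`. [folklore] -/
theorem am1_one_sub_gauss_mem (r : ℝ) :
    0 ≤ 4 * (1 - Real.exp (-(r ^ 2 / 4))) ∧ 4 * (1 - Real.exp (-(r ^ 2 / 4))) ≤ r ^ 2 := by
  have h1 : Real.exp (-(r ^ 2 / 4)) ≤ 1 := Real.exp_le_one_iff.2 (by nlinarith [sq_nonneg r])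
  have h2 := Real.add_one_le_exp (-(r ^ 2 / 4))
  constructor <;> nlinarith

/-- **The cross identity.** For a continuous Gaussian-class `g`,
`½ ∫₀^∞ (A_g(r) A⋆(r)/r³ + r B_g(r) B⋆(r)) dr = ∫₀^∞ 4(1 − e^{−r²/4}) g(r) dr`
(`A⋆ = 8 − 2(r²+4)e^{−r²/4}`, `B⋆ = 2e^{−r²/4}`): the polarised energy of `g` against the neutral mode
`a⋆` is `⟨g, a⋆⟩_{L²(Φ⁻¹ r dr)}` — `a⋆` is an eigenvector (eigenvalue `1`) of `A⁻¹B₁`. Proof: one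
integration by parts with `Λ = ½A_gV + ½B_gW`, `V = −4(1−e^{−r²/4})/r²`, `W = 4(1−e^{−r²/4})`. [folklore] -/
theorem am1_cross_identity {g : ℝ → ℝ} (hg : Continuous g) {C : ℝ} {N : ℕ}
    (hb : ∀ r, 0 ≤ r → |g r| ≤ C * (1 + r) ^ N * Real.exp (-(r ^ 2 / 4))) :
    IntegrableOn (fun r : ℝ =>
        (∫ s in (0 : ℝ)..r, s ^ 2 * g s) * (8 - 2 * (r ^ 2 + 4) * Real.exp (-(r ^ 2 / 4))) / r ^ 3 +
          r * ((∫ s in Ioi r, g s) * (2 * Real.exp (-(r ^ 2 / 4))))) (Ioi 0) ∧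
    (1 / 2) * ∫ r in Ioi (0 : ℝ),
        ((∫ s in (0 : ℝ)..r, s ^ 2 * g s) * (8 - 2 * (r ^ 2 + 4) * Real.exp (-(r ^ 2 / 4))) / r ^ 3 +
          r * ((∫ s in Ioi r, g s) * (2 * Real.exp (-(r ^ 2 / 4))))) =
      ∫ r in Ioi (0 : ℝ), 4 * (1 - Real.exp (-(r ^ 2 / 4))) * g r := by
  set A : ℝ → ℝ := fun r => ∫ s in (0 : ℝ)..r, s ^ 2 * g s with hA
  set B : ℝ → ℝ := fun r => ∫ s in Ioi r, g s with hB
  set E : ℝ → ℝ := fun r => Real.exp (-(r ^ 2 / 4)) with hE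
  set As : ℝ → ℝ := fun r => 8 - 2 * (r ^ 2 + 4) * E r with hAs
  set V : ℝ → ℝ := fun r => -4 * (1 - E r) / r ^ 2 with hV
  set W : ℝ → ℝ := fun r => 4 * (1 - E r) with hW
  obtain ⟨K, hK0, hK8, -, hK⟩ := am1_gc_consts hb
  obtain ⟨KB, hKB0, hKB⟩ := am1_abs_B_le_exp hg hK0 hK8
  have hgi : IntegrableOn g (Ioi 0) :=
    (am1_integrableOn_pow_mul hg hb 0).congr_fun (fun r _ => by simp) measurableSet_Ioi
  set I₀ : ℝ := ∫ s in Ioi (0 : ℝ), |g s| with hI₀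
  set I₂ : ℝ := ∫ s in Ioi (0 : ℝ), s ^ 2 * |g s| with hI₂
  have hI₀0 : 0 ≤ I₀ := setIntegral_nonneg measurableSet_Ioi fun s _ => abs_nonneg _
  have hI₂0 : 0 ≤ I₂ := setIntegral_nonneg measurableSet_Ioi fun s _ => mul_nonneg (sq_nonneg s) (abs_nonneg _)
  have hAc : Continuous A := continuous_iff_continuousAt.2 fun r => (am1_hasDerivAt_A hg r).continuousAt
  have hBc : ContinuousOn B (Ici 0) := am1_continuousOn_B hg hgi
  have hA3 : ∀ r, 0 ≤ r → |A r| ≤ K * r ^ 3 := fun r hr => am1_abs_A_le_cube hK hr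
  have hAI : ∀ r, 0 ≤ r → |A r| ≤ I₂ := fun r hr => am1_abs_A_le_integral hg hb hr
  have hBI : ∀ r, 0 ≤ r → |B r| ≤ I₀ := fun r hr => am1_abs_B_le_integral hgi hr
  have hEc : Continuous E := by simp only [hE]; fun_prop
  -- the neutral mode as a Gaussian-class function, and its functionals
  have haS : Continuous fun s : ℝ => s * Real.exp (-(s ^ 2 / 4)) := by fun_prop
  have hAstar : ∀ r : ℝ, (∫ s in (0 : ℝ)..r, s ^ 2 * (s * Real.exp (-(s ^ 2 / 4)))) = As r := fun r =>
    am1_integral_sq_mul_aStar r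
  have hBstar : ∀ r : ℝ, 0 ≤ r → (∫ s in Ioi r, s * Real.exp (-(s ^ 2 / 4))) = 2 * E r := fun r hr =>
    am1_integral_Ioi_aStar hr
  -- integrands: `x` (cross energy) and the right-hand side
  set x : ℝ → ℝ := fun r => (1 / 2) * (A r * As r / r ^ 3 + r * (B r * (2 * E r))) with hx
  have hxi : IntegrableOn x (Ioi 0) := by
    -- AM–GM against the squares, whose integrability is `am1_integrableOn_A_sq_div/mul_B_sq`
    have h1 := am1_integrableOn_A_sq_div hg hb
    have h2 := am1_integrableOn_mul_B_sq hg hb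
    have h3 := am1_integrableOn_A_sq_div haS am1_gc_aStar
    have h4 := am1_integrableOn_mul_B_sq haS am1_gc_aStar
    have h3' : IntegrableOn (fun r : ℝ => As r ^ 2 / r ^ 3) (Ioi 0) :=
      h3.congr_fun (fun r _ => by simp only [hAstar r]) measurableSet_Ioi
    have h4' : IntegrableOn (fun r : ℝ => r * (2 * E r) ^ 2) (Ioi 0) :=
      h4.congr_fun (fun r hr => by simp only [hBstar r (le_of_lt hr)]) measurableSet_Ioi
    have hmeas : AEStronglyMeasurable x (volume.restrict (Ioi 0)) := by
      refine ContinuousOn.aestronglyMeasurable ?_ measurableSet_Ioi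
      simp only [hx]
      refine ContinuousOn.mul continuousOn_const (ContinuousOn.add ?_ ?_)
      · exact ((hAc.continuousOn).mul ((continuous_const.sub ((continuous_const.mul
          ((continuous_pow 2).add continuous_const)).mul hEc)).continuousOn)).div
          ((continuous_pow 3).continuousOn) fun r hr => pow_ne_zero 3 (ne_of_gt hr)
      · exact continuousOn_id.mul ((hBc.mono Ioi_subset_Ici_self).mul
          ((continuous_const.mul hEc).continuousOn))
    refine Integrable.mono' ((((h1.add h3').add (h2.add h4')).const_mul (1 / 2)).const_mul (1 / 2))
      hmeas ?_
    refine (ae_restrict_iff' measurableSet_Ioi).2 (Eventually.of_forall fun r hr => ?_)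
    have hr0 : 0 < r := hr
    have hr3 : 0 < r ^ 3 := pow_pos hr0 3
    rw [Real.norm_eq_abs, hx]
    simp only [Pi.add_apply]
    rw [abs_mul, abs_of_pos (by norm_num : (0 : ℝ) < 1 / 2)]
    refine mul_le_mul_of_nonneg_left ?_ (by norm_num)
    refine (abs_add_le _ _).trans ?_
    rw [abs_div, abs_of_pos hr3, abs_mul, abs_mul, abs_of_pos hr0, abs_mul]
    have e1 : |A r| * |As r| / r ^ 3 ≤ (1 / 2) * (A r ^ 2 / r ^ 3 + As r ^ 2 / r ^ 3) := by
      have h : |A r| * |As r| ≤ (1 / 2) * (A r ^ 2 + As r ^ 2) := by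
        nlinarith [sq_nonneg (|A r| - |As r|), sq_abs (A r), sq_abs (As r)]
      calc |A r| * |As r| / r ^ 3 ≤ (1 / 2) * (A r ^ 2 + As r ^ 2) / r ^ 3 :=
            div_le_div_of_nonneg_right h hr3.le
        _ = _ := by ring
    have e2 : r * (|B r| * |2 * E r|) ≤ (1 / 2) * (r * B r ^ 2 + r * (2 * E r) ^ 2) := by
      nlinarith [mul_nonneg hr0.le (sq_nonneg (|B r| - |2 * E r|)), sq_abs (B r), sq_abs (2 * E r)]
    linarith
  have hri : IntegrableOn (fun r : ℝ => 4 * (1 - E r) * g r) (Ioi 0) := by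
    refine Integrable.mono' (hgi.abs.const_mul 4) ?_ ?_
    · exact ((continuous_const.mul (continuous_const.sub hEc)).mul hg).aestronglyMeasurable
    refine (ae_restrict_iff' measurableSet_Ioi).2 (Eventually.of_forall fun r _ => ?_)
    have hm := am1_one_sub_gauss_mem r
    rw [Real.norm_eq_abs, abs_mul, abs_of_nonneg hm.1]
    refine mul_le_mul_of_nonneg_right ?_ (abs_nonneg _)
    have : E r ≤ 1 := Real.exp_le_one_iff.2 (by nlinarith [sq_nonneg r])
    have : 0 < E r := Real.exp_pos _
    simp only [hE] at *
    nlinarith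
  -- the primitive and its derivative
  set Λ : ℝ → ℝ := fun r => (1 / 2) * (A r * V r) + (1 / 2) * (B r * W r) with hΛ
  have hderiv : ∀ r, 0 < r → HasDerivAt Λ (x r - 4 * (1 - E r) * g r) r := by
    intro r hr
    have hA' : HasDerivAt A (r ^ 2 * g r) r := am1_hasDerivAt_A hg r
    have hB' : HasDerivAt B (-g r) r := am1_hasDerivAt_B hg hgi hr
    have hE' : HasDerivAt E (-(r / 2) * E r) r := am1_hasDerivAt_gauss r
    have hV' : HasDerivAt V (((-4) * (-(-(r / 2) * E r)) * r ^ 2 - (-4 * (1 - E r)) * (↑2 * r ^ (2 - 1))) /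
        (r ^ 2) ^ 2) r :=
      ((hE'.const_sub 1).const_mul (-4)).div (hasDerivAt_pow 2 r) (pow_ne_zero 2 hr.ne')
    have hW' : HasDerivAt W (4 * (-(-(r / 2) * E r))) r := (hE'.const_sub 1).const_mul 4
    have h := ((hA'.mul hV').const_mul (1 / 2)).add ((hB'.mul hW').const_mul (1 / 2))
    refine h.congr_deriv ?_
    simp only [hx, hAs, hV, hW]
    push_cast
    field_simp
    ring
  -- boundary values
  have hVb : ∀ r, 0 < r → |V r| ≤ 1 ∧ |V r| ≤ 4 / r ^ 2 := by
    intro r hr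
    have hm := am1_one_sub_gauss_mem r
    have hr2 : 0 < r ^ 2 := pow_pos hr 2
    simp only [hV]
    rw [abs_div, abs_of_pos hr2, show -4 * (1 - E r) = -(4 * (1 - E r)) by ring, abs_neg,
      abs_of_nonneg hm.1, div_le_one hr2, div_le_div_iff_of_pos_right hr2]
    refine ⟨hm.2, ?_⟩
    have : 0 < E r := Real.exp_pos _
    simp only [hE] at *
    nlinarith
  have hWb : ∀ r, 0 ≤ W r ∧ W r ≤ r ^ 2 ∧ W r ≤ 4 := by
    intro r
    have hm := am1_one_sub_gauss_mem r
    have : 0 < E r := Real.exp_pos _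
    simp only [hW, hE] at *
    exact ⟨hm.1, hm.2, by nlinarith⟩
  have h0 : Tendsto Λ (𝓝[>] 0) (𝓝 0) := by
    refine am1_tendsto_zero_nhdsGT (b := fun r => (1 / 2) * (K * r ^ 3) + (1 / 2) * (I₀ * r ^ 2))
      (by fun_prop) (by simp) fun r hr => ?_
    simp only [hΛ]
    refine (abs_add_le _ _).trans ?_
    rw [abs_mul, abs_mul, abs_mul, abs_mul, abs_of_pos (by norm_num : (0 : ℝ) < 1 / 2),
      abs_of_nonneg (hWb r).1]
    gcongr (1 / 2) * ?_ + (1 / 2) * ?_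
    · calc |A r| * |V r| ≤ K * r ^ 3 * 1 :=
            mul_le_mul (hA3 r hr.le) (hVb r hr).1 (abs_nonneg _) (by positivity)
        _ = K * r ^ 3 := mul_one _
    · exact mul_le_mul (hBI r hr.le) (hWb r).2.1 (hWb r).1 hI₀0
  have hinf : Tendsto Λ atTop (𝓝 0) := by
    have hb1 : Tendsto (fun r : ℝ => (1 / 2) * (I₂ * (4 * (r ^ 2)⁻¹)) +
        (1 / 2) * (KB * Real.exp (-(r ^ 2 / 16)) * 4)) atTop (𝓝 0) := by
      have h1 := ((tendsto_inv_atTop_zero.comp (tendsto_pow_atTop two_ne_zero)).const_mul 4).const_mul I₂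
      have h2 := ((am1_tendsto_pow_mul_exp_neg_sq 0 (by norm_num : (0 : ℝ) < 16)).const_mul KB).mul_const 4
      have h := (h1.const_mul (1 / 2)).add (h2.const_mul (1 / 2))
      simp only [mul_zero, zero_mul, add_zero, pow_zero, one_mul] at h
      exact h
    refine squeeze_zero_norm' ?_ hb1
    filter_upwards [eventually_gt_atTop (0 : ℝ)] with r hr
    rw [Real.norm_eq_abs]
    simp only [hΛ]
    refine (abs_add_le _ _).trans ?_
    rw [abs_mul, abs_mul, abs_mul, abs_mul, abs_of_pos (by norm_num : (0 : ℝ) < 1 / 2),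
      abs_of_nonneg (hWb r).1]
    gcongr (1 / 2) * ?_ + (1 / 2) * ?_
    · refine mul_le_mul (hAI r hr.le) ?_ (abs_nonneg _) hI₂0
      rw [← div_eq_mul_inv]; exact (hVb r hr).2
    · exact mul_le_mul (hKB r hr.le) (hWb r).2.2 (hWb r).1 (by positivity)
  have hzero := am1_integral_Ioi_eq_zero_of_hasDerivAt hderiv (hxi.sub hri) h0 hinf
  rw [integral_sub hxi hri, sub_eq_zero] at hzero
  have hxi' : IntegrableOn (fun r : ℝ => A r * As r / r ^ 3 + r * (B r * (2 * E r))) (Ioi 0) := by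
    have h : IntegrableOn (fun r : ℝ => 2 * x r) (Ioi 0) := hxi.const_mul 2
    refine h.congr_fun (fun r _ => ?_) measurableSet_Ioi
    simp only [hx]; ring
  refine ⟨hxi', ?_⟩
  rw [← hzero, hx, ← integral_const_mul]

/-- `∫₀^∞ 4(1 − e^{−r²/4}) · r e^{−r²/4} dr = 4` (`= 4∫ r(e^{−r²/4} − e^{−r²/2}) = 4(2 − 1)`): the
`L²(Φ⁻¹ r dr)`-norm² of the neutral mode `a⋆`. [folklore] -/
theorem am1_integral_q_mul_aStar :
    (∫ r in Ioi (0 : ℝ), 4 * (1 - Real.exp (-(r ^ 2 / 4))) * (r * Real.exp (-(r ^ 2 / 4)))) = 4 := by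
  obtain ⟨h4v, h4i⟩ := integral_Ioi_mul_exp_neg_sq_div (c := 4) (by norm_num) (le_refl (0 : ℝ))
  obtain ⟨h2v, h2i⟩ := integral_Ioi_mul_exp_neg_sq_div (c := 2) (by norm_num) (le_refl (0 : ℝ))
  have hpt : ∀ r : ℝ, 4 * (1 - Real.exp (-(r ^ 2 / 4))) * (r * Real.exp (-(r ^ 2 / 4))) =
      4 * (r * Real.exp (-(r ^ 2 / 4))) - 4 * (r * Real.exp (-(r ^ 2 / 2))) := by
    intro r
    have : Real.exp (-(r ^ 2 / 4)) * Real.exp (-(r ^ 2 / 4)) = Real.exp (-(r ^ 2 / 2)) := by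
      rw [← Real.exp_add]; ring_nf
    linear_combination (-4 * r) * this
  simp_rw [hpt]
  rw [integral_sub (h4i.const_mul 4) (h2i.const_mul 4), MeasureTheory.integral_const_mul,
    MeasureTheory.integral_const_mul, h4v, h2v]
  norm_num

/-- **The energy of the neutral mode is `4`**: `½∫₀^∞ (A⋆²/r³ + r B⋆²) dr = 4`
(`= ⟨a⋆, a⋆⟩_{L²(Φ⁻¹ r dr)}`, by the cross identity at `g = a⋆`), with the integrability of the
integrand. [folklore] -/
theorem am1_energy_aStar :
    IntegrableOn (fun r : ℝ => (8 - 2 * (r ^ 2 + 4) * Real.exp (-(r ^ 2 / 4))) ^ 2 / r ^ 3 +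
        r * (2 * Real.exp (-(r ^ 2 / 4))) ^ 2) (Ioi 0) ∧
    (1 / 2) * ∫ r in Ioi (0 : ℝ), ((8 - 2 * (r ^ 2 + 4) * Real.exp (-(r ^ 2 / 4))) ^ 2 / r ^ 3 +
        r * (2 * Real.exp (-(r ^ 2 / 4))) ^ 2) = 4 := by
  have haS : Continuous fun s : ℝ => s * Real.exp (-(s ^ 2 / 4)) := by fun_prop
  obtain ⟨hi, h⟩ := am1_cross_identity haS am1_gc_aStar
  have hpt : EqOn (fun r : ℝ => (∫ s in (0 : ℝ)..r, s ^ 2 * (s * Real.exp (-(s ^ 2 / 4)))) *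
      (8 - 2 * (r ^ 2 + 4) * Real.exp (-(r ^ 2 / 4))) / r ^ 3 +
      r * ((∫ s in Ioi r, s * Real.exp (-(s ^ 2 / 4))) * (2 * Real.exp (-(r ^ 2 / 4)))))
      (fun r : ℝ => (8 - 2 * (r ^ 2 + 4) * Real.exp (-(r ^ 2 / 4))) ^ 2 / r ^ 3 +
        r * (2 * Real.exp (-(r ^ 2 / 4))) ^ 2) (Ioi 0) := by
    intro r hr
    simp only
    rw [am1_integral_sq_mul_aStar r, am1_integral_Ioi_aStar (le_of_lt hr)]
    ring
  refine ⟨hi.congr_fun hpt measurableSet_Ioi, ?_⟩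
  rw [setIntegral_congr_fun measurableSet_Ioi hpt, am1_integral_q_mul_aStar] at h
  exact h

/-! ### The registered tools stub -/

/-- **Registered tools stub `stub_arnoldModeOne1DToolsD`** (helpers for `stub_arnoldModeOne1D`, line
`Sketch` of crux `CoreLinearInvertibility`, stmt-NavierStokesRegularity-17973): the second trace identity,
the cross identity against the neutral mode, and the energy `4` of the neutral mode. [folklore] -/
theorem stub_arnoldModeOne1DToolsD :
    (∫ r in Set.Ioi (0 : ℝ), r * ∫ s in Set.Ioi r, kerWeight s / s =
      (1 / 2) * ∫ r in Set.Ioi (0 : ℝ), r * kerWeight r) ∧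
    (∀ (g : ℝ → ℝ) (C : ℝ) (N : ℕ), Continuous g →
      (∀ r : ℝ, 0 ≤ r → |g r| ≤ C * (1 + r) ^ N * Real.exp (-(r ^ 2 / 4))) →
      (1 / 2) * ∫ r in Set.Ioi (0 : ℝ),
        ((∫ s in (0 : ℝ)..r, s ^ 2 * g s) * (8 - 2 * (r ^ 2 + 4) * Real.exp (-(r ^ 2 / 4))) / r ^ 3 +
          r * ((∫ s in Set.Ioi r, g s) * (2 * Real.exp (-(r ^ 2 / 4))))) =
      ∫ r in Set.Ioi (0 : ℝ), 4 * (1 - Real.exp (-(r ^ 2 / 4))) * g r) ∧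
    ((1 / 2) * ∫ r in Set.Ioi (0 : ℝ), ((8 - 2 * (r ^ 2 + 4) * Real.exp (-(r ^ 2 / 4))) ^ 2 / r ^ 3 +
        r * (2 * Real.exp (-(r ^ 2 / 4))) ^ 2) = 4) :=
  ⟨am1_integral_mul_G.2, fun _ _ _ hg hb => (am1_cross_identity hg hb).2, am1_energy_aStar.2⟩

end Summit.NavierStokesRegularity.NavierStokesRegularity.Theorems
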